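import Summits.HubbardSuperconductivity.HubbardSuperconductivity.Theorems.AnisotropyChordTransferFibre3Resolvent
import Summits.HubbardSuperconductivity.HubbardSuperconductivity.Theorems.AnisotropyChordTransferFibre3KreinForward

/-!
# Route `AnisotropyChord` / H0 rotor rung: PORT N30-A proofs, part 6 — THE KREIN INEQUALITY AND `CertLogic`

Conclusion of the Krein reduction (memo ROTOR-THEORY-20 §277(a), theory seat `hubbard-h0-rotor-theory-1`, cycle 20):
for `L ≥ 4`, `Δ ≠ 0`, `0 < T < 2ε₁`, every eigenvalue `ε₁ + T` of the symmetric hard-core `K₁` sector satisfies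
`Φ(T) ≤ T` — **`kreinForward_holds : KreinForward L Δ`** — hence **`certLogic_holds : CertLogic L Δ`** (PORT SPEC N30-A,
first theorem target, now unconditional).  Proof: with the charge `ρ = (H₀ − E)Ψ` (supported on `D ∪ S`, equal to `ΔWΨ`
off the hard core), `G ρ = Ψ − βv` with `β = ⟨v,Ψ⟩/3V²` (`Gapply_H0E`, `PiPole_symm`) and `⟨v, ρ⟩ = −3V²Tβ`
(`ip_vfun_H0apply`).  If the Krein matrix `𝒩(T)` is singular, `Φ(T) = 0 ≤ T` (total inverse).  Otherwise `β ≠ 0` (else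
`ρ|_{D⊕S} ≠ 0` would be a null vector of `𝒩`), `x = −ρ/β` solves `𝒩x = v` on `D ⊕ S` (the `D` rows are the hard core
`Ψ|_D = 0`, the `S` rows use `ρ_S = ΔWΨ_S`), so `⟨v, 𝒩⁻¹v⟩ = ⟨v, x⟩ = −⟨v,ρ⟩/β = 3V²T`, i.e. `Φ(T) = T`.
Prover seat `hubbard-h0-rotor-p1` g21; helper for stmt-HubbardSuperconductivity-19089 (`--supports`).
-/

set_option linter.dupNamespace false
set_option autoImplicit false

noncomputable section

open scoped BigOperators
open Complex Matrix

namespace Summit.HubbardSuperconductivity.HubbardSuperconductivity.Theorems.AnisotropyChord.Transfer.Fibre3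

variable (L : ℕ) [NeZero L]

/-! ## Sums over `D ⊕ S` -/

omit [NeZero L] in
/-- on the hard core the shell indicator is off. [folklore] -/
theorem InS_of_InD {c : Cfg L} (h : InD L c = true) : InS L c = false := by
  unfold InS; rw [h]; rfl

omit [NeZero L] in
/-- off `D ∪ S` there is no nearest-neighbour pair: `W = 0`. [folklore] -/
theorem Wcount_eq_zero {c : Cfg L} (hD : InD L c = false) (hS : InS L c = false) : Wcount L c = 0 := by
  unfold InS at hS
  rw [hD] at hS
  simp only [Bool.not_false, Bool.true_and, decide_eq_false_iff_not, not_le, Nat.lt_one_iff] at hS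
  exact hS

omit [NeZero L] in
/-- on the shell `W ≥ 1`. [folklore] -/
theorem Wcount_pos_of_InS {c : Cfg L} (hS : InS L c = true) : 1 ≤ Wcount L c := by
  unfold InS at hS
  simp only [Bool.and_eq_true, Bool.not_eq_true', decide_eq_true_eq] at hS
  exact hS.2

/-- a function vanishing off `D ∪ S` sums over `D ⊕ S` as over the whole fibre. [folklore] -/
theorem sum_DS_eq (g : Cfg L → ℂ) (hg : ∀ c, InD L c = false → InS L c = false → g c = 0) :
    ∑ i : DS L, g (cfgOf L i) = ∑ c : Cfg L, g c := by
  classical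
  rw [Fintype.sum_sum_type]
  simp only [cfgOf]
  have h1 : ∑ d : {c : Cfg L // InD L c = true}, g d.1 = ∑ c : Cfg L, if InD L c = true then g c else 0 := by
    rw [← Finset.sum_filter]
    exact (Finset.sum_subtype (Finset.univ.filter (fun c => InD L c = true)) (by simp) g).symm
  have h2 : ∑ s : {c : Cfg L // InS L c = true}, g s.1 = ∑ c : Cfg L, if InS L c = true then g c else 0 := by
    rw [← Finset.sum_filter]
    exact (Finset.sum_subtype (Finset.univ.filter (fun c => InS L c = true)) (by simp) g).symm
  rw [h1, h2, ← Finset.sum_add_distrib]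
  refine Finset.sum_congr rfl fun c _ => ?_
  by_cases hD : InD L c = true
  · simp [hD, InS_of_InD L hD]
  · have hD' : InD L c = false := by simpa using hD
    by_cases hS : InS L c = true
    · simp [hD, hS]
    · have hS' : InS L c = false := by simpa using hS
      simp [hD, hS, hg c hD' hS']

/-! ## The Krein matrix acting on vectors -/

/-- entries of `𝒩` in a `D` row. [folklore] -/
theorem Nmat_inl (T Δ : ℝ) (d : {c : Cfg L // InD L c = true}) (j : DS L) :
    Nmat L T Δ (Sum.inl d) j = Gentry L T d.1 (cfgOf L j) := by
  cases j <;> simp [Nmat, cfgOf]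

/-- entries of `𝒩` in an `S` row, `D` column. [folklore] -/
theorem Nmat_inr_inl (T Δ : ℝ) (s : {c : Cfg L // InS L c = true}) (d : {c : Cfg L // InD L c = true}) :
    Nmat L T Δ (Sum.inr s) (Sum.inl d) = Gentry L T s.1 d.1 := by
  simp [Nmat, cfgOf]

/-- entries of `𝒩` in the `S × S` block. [folklore] -/
theorem Nmat_inr_inr (T Δ : ℝ) (s s' : {c : Cfg L // InS L c = true}) :
    Nmat L T Δ (Sum.inr s) (Sum.inr s')
      = Gentry L T s.1 s'.1 - (if s = s' then ((1 / (Δ * (Wcount L s.1 : ℝ)) : ℝ) : ℂ) else 0) := by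
  simp [Nmat, cfgOf]

/-- `𝒩 x` on a `D` row: the resolvent sum. [folklore] -/
theorem Nmat_mulVec_inl (T Δ : ℝ) (x : DS L → ℂ) (d : {c : Cfg L // InD L c = true}) :
    (Nmat L T Δ *ᵥ x) (Sum.inl d) = ∑ j : DS L, Gentry L T d.1 (cfgOf L j) * x j := by
  simp only [Matrix.mulVec, dotProduct, Nmat_inl]

/-- `𝒩 x` on an `S` row: the resolvent sum minus `x_s/(ΔW_s)`. [folklore] -/
theorem Nmat_mulVec_inr (T Δ : ℝ) (x : DS L → ℂ) (s : {c : Cfg L // InS L c = true}) :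
    (Nmat L T Δ *ᵥ x) (Sum.inr s)
      = ∑ j : DS L, Gentry L T s.1 (cfgOf L j) * x j - ((1 / (Δ * (Wcount L s.1 : ℝ)) : ℝ) : ℂ) * x (Sum.inr s) := by
  classical
  simp only [Matrix.mulVec, dotProduct]
  rw [Fintype.sum_sum_type, Fintype.sum_sum_type]
  simp only [Nmat_inr_inl, Nmat_inr_inr, cfgOf, sub_mul, Finset.sum_sub_distrib, ite_mul, zero_mul,
    Finset.sum_ite_eq, Finset.mem_univ, if_true]
  ring

/-- the resolvent sum over `D ⊕ S` of a charge supported on `D ∪ S` is `G` applied to it. [folklore] -/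
theorem sum_Gentry_DS (T : ℝ) (f : Cfg L → ℂ) (hf : ∀ c, InD L c = false → InS L c = false → f c = 0) (c : Cfg L) :
    ∑ j : DS L, Gentry L T c (cfgOf L j) * f (cfgOf L j) = Gapply L T f c := by
  unfold Gapply
  exact sum_DS_eq L (fun c' => Gentry L T c c' * f c') (fun c' hD hS => by rw [hf c' hD hS, mul_zero])

/-! ## THE KREIN INEQUALITY -/

/-- **KREIN, forward direction, proved:** for `L ≥ 4`, `Δ ≠ 0` and `0 < T < 2ε₁`, if `ε₁ + T` is an eigenvalue of the
symmetric hard-core `K₁` sector then `Φ(T) ≤ T` (with equality when `𝒩(T)` is invertible). [folklore] -/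
theorem kreinForward_holds (hL : 4 ≤ L) {Δ : ℝ} (hΔ : Δ ≠ 0) : KreinForward L Δ := by
  classical
  intro T hT0 hT2 hE
  have hL2 : 2 ≤ L := by omega
  obtain ⟨Ψ, ⟨hsym, hD, hne⟩, heig⟩ := hE
  set E : ℝ := eps1 L + T with hE_def
  -- the charge
  set ρ : Cfg L → ℂ := fun d => H0apply L (K1 L) Ψ d - ((eps1 L + T : ℝ) : ℂ) * Ψ d with hρ_def
  have hρ_off : ∀ c, InD L c = false → ρ c = (Δ : ℂ) * (Wcount L c : ℂ) * Ψ c := by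
    intro c hc
    have h := heig c hc
    unfold Happly at h
    simp only [hρ_def]
    rw [← hE_def]
    linear_combination h
  have hρ_zero : ∀ c, InD L c = false → InS L c = false → ρ c = 0 := by
    intro c hDc hSc
    rw [hρ_off c hDc, Wcount_eq_zero L hDc hSc]; simp
  -- pole decomposition
  set V2 : ℂ := ((L : ℂ) ^ 2) ^ 2 with hV2
  have hV2ne : V2 ≠ 0 := by
    have : (L : ℂ) ≠ 0 := by exact_mod_cast (NeZero.ne L)
    rw [hV2]; positivity
  set β : ℂ := ip L (vfun L) Ψ / (3 * V2) with hβ_def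
  have hG : ∀ c, Gapply L T ρ c = Ψ c - β * vfun L c := by
    intro c
    rw [hρ_def, Gapply_H0E L hL hT2 Ψ c, PiPole_symm L hL2 hsym c]
  have hvρ : ip L (vfun L) ρ = -(T : ℂ) * ip L (vfun L) Ψ := by
    have h1 : ip L (vfun L) ρ = ip L (vfun L) (H0apply L (K1 L) Ψ) - ((eps1 L + T : ℝ) : ℂ) * ip L (vfun L) Ψ := by
      unfold ip; rw [Finset.mul_sum, ← Finset.sum_sub_distrib]
      refine Finset.sum_congr rfl fun d _ => ?_
      simp only [hρ_def]; ring
    rw [h1, ip_vfun_H0apply L hL2]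
    push_cast; ring
  -- Φ ≤ T
  unfold Phi
  by_cases hunit : IsUnit (Nmat L T Δ).det
  swap
  · rw [Matrix.nonsing_inv_apply_not_isUnit _ hunit, Matrix.zero_mulVec, dotProduct_zero, Complex.zero_re, zero_div]
    exact hT0.le
  -- invertible case: β ≠ 0
  have hβ : β ≠ 0 := by
    intro hβ0
    have hGΨ : ∀ c, Gapply L T ρ c = Ψ c := by intro c; rw [hG c, hβ0]; ring
    -- ρ restricted to D ⊕ S is a null vector of 𝒩
    set z : DS L → ℂ := fun i => ρ (cfgOf L i) with hz
    have hNz : Nmat L T Δ *ᵥ z = 0 := by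
      funext i
      cases i with
      | inl d =>
        rw [Nmat_mulVec_inl, Pi.zero_apply]
        simp only [hz]
        rw [sum_Gentry_DS L T ρ hρ_zero, hGΨ]
        have := hD d.1 d.2
        exact this
      | inr s =>
        rw [Nmat_mulVec_inr, Pi.zero_apply]
        have e1 : ∑ j : DS L, Gentry L T s.1 (cfgOf L j) * z j = Gapply L T ρ s.1 := by
          simp only [hz]; exact sum_Gentry_DS L T ρ hρ_zero s.1
        rw [e1, hGΨ]
        simp only [hz, cfgOf]
        have hSD : InD L s.1 = false := by
          have h := s.2; unfold InS at h
          simp only [Bool.and_eq_true, Bool.not_eq_true'] at h; exact h.1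
        rw [hρ_off s.1 hSD]
        have hW : (Wcount L s.1 : ℝ) ≠ 0 := by
          have := Wcount_pos_of_InS L s.2; exact_mod_cast (by omega : Wcount L s.1 ≠ 0)
        have hW' : (Wcount L s.1 : ℂ) ≠ 0 := by exact_mod_cast (show (Wcount L s.1 : ℝ) ≠ 0 from hW)
        have hΔ' : (Δ : ℂ) ≠ 0 := by exact_mod_cast hΔ
        push_cast
        field_simp
        ring
    have hz0 : z ≠ 0 := by
      intro hz0
      apply hne
      funext c
      have hρ0 : ρ = 0 := by
        funext c'
        by_cases hD' : InD L c' = true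
        · have := congrFun hz0 (Sum.inl ⟨c', hD'⟩); simpa [hz, cfgOf] using this
        · by_cases hS' : InS L c' = true
          · have := congrFun hz0 (Sum.inr ⟨c', hS'⟩); simpa [hz, cfgOf] using this
          · exact hρ_zero c' (by simpa using hD') (by simpa using hS')
      rw [← hGΨ c, hρ0]
      unfold Gapply; simp
    have hdet : (Nmat L T Δ).det = 0 := Matrix.exists_mulVec_eq_zero_iff.mp ⟨z, hz0, hNz⟩
    rw [hdet] at hunit
    exact not_isUnit_zero hunit
  -- the Krein vector x = −ρ/β solves 𝒩 x = v
  set x : DS L → ℂ := fun i => -ρ (cfgOf L i) / β with hx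
  have hNx : Nmat L T Δ *ᵥ x = vpole L := by
    funext i
    have hsum : ∀ c, ∑ j : DS L, Gentry L T c (cfgOf L j) * x j = -(Gapply L T ρ c) / β := by
      intro c
      simp only [hx]
      have : ∑ j : DS L, Gentry L T c (cfgOf L j) * (-ρ (cfgOf L j) / β)
          = (-1 / β) * ∑ j : DS L, Gentry L T c (cfgOf L j) * ρ (cfgOf L j) := by
        rw [Finset.mul_sum]; refine Finset.sum_congr rfl fun j _ => ?_; ring
      rw [this, sum_Gentry_DS L T ρ hρ_zero]; ring
    cases i with
    | inl d =>
      rw [Nmat_mulVec_inl, hsum, hG]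
      have h0 : Ψ d.1 = 0 := hD d.1 d.2
      rw [h0]
      simp only [vpole, cfgOf, vfun]
      field_simp
      ring
    | inr s =>
      rw [Nmat_mulVec_inr, hsum, hG]
      simp only [hx, vpole, cfgOf, vfun]
      have hSD : InD L s.1 = false := by
        have h := s.2; unfold InS at h
        simp only [Bool.and_eq_true, Bool.not_eq_true'] at h; exact h.1
      rw [hρ_off s.1 hSD]
      have hW : (Wcount L s.1 : ℂ) ≠ 0 := by
        have := Wcount_pos_of_InS L s.2
        exact_mod_cast (by omega : Wcount L s.1 ≠ 0)
      have hΔ' : (Δ : ℂ) ≠ 0 := by exact_mod_cast hΔ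
      push_cast
      field_simp
      ring
  have hinv : (Nmat L T Δ)⁻¹ *ᵥ vpole L = x := by
    rw [← hNx, Matrix.mulVec_mulVec, Matrix.nonsing_inv_mul _ hunit, Matrix.one_mulVec]
  rw [hinv]
  -- ⟨v, x⟩ = −⟨v, ρ⟩/β = 3V²T
  have hvx : star (vpole L) ⬝ᵥ x = -(1 / β) * ip L (vfun L) ρ := by
    set g : Cfg L → ℂ := fun c => -(1 / β) * ((starRingEnd ℂ) (vfun L c) * ρ c) with hg
    have hvp : ∀ i : DS L, vpole L i = vfun L (cfgOf L i) := fun i => rfl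
    have hg0 : ∀ c, InD L c = false → InS L c = false → g c = 0 := by
      intro c hD' hS'; simp only [hg, hρ_zero c hD' hS', mul_zero]
    unfold dotProduct ip
    calc ∑ i : DS L, star (vpole L) i * x i = ∑ i : DS L, g (cfgOf L i) := by
          refine Finset.sum_congr rfl fun i _ => ?_
          simp only [hg, hx, Pi.star_apply, hvp, Complex.star_def]
          ring
      _ = ∑ c : Cfg L, g c := sum_DS_eq L g hg0
      _ = -(1 / β) * ∑ c : Cfg L, (starRingEnd ℂ) (vfun L c) * ρ c := by
          simp only [hg]; rw [Finset.mul_sum]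
  rw [hvx, hvρ]
  have hβ' : ip L (vfun L) Ψ = β * (3 * V2) := by rw [hβ_def]; field_simp
  rw [hβ']
  have : (-(1 / β) * (-(T : ℂ) * (β * (3 * V2)))) = ((T * (3 * ((L : ℝ) ^ 2) ^ 2) : ℝ) : ℂ) := by
    rw [hV2]; push_cast; field_simp
  rw [this, Complex.ofReal_re]
  have hV : (0 : ℝ) < 3 * ((L : ℝ) ^ 2) ^ 2 := by
    have : (0 : ℝ) < L := by exact_mod_cast Nat.pos_of_ne_zero (NeZero.ne L)
    positivity
  rw [mul_div_assoc, div_self hV.ne', mul_one]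

/-- **`CertLogic` holds** (PORT SPEC N30-A, first theorem target): for `L ≥ 4` and `Δ ≠ 0`, NOBIND(K₁) ∧ (`Φ(T) > T` on
`(0, T*]`) ∧ (an admissible `K = 0` function with Rayleigh quotient `≤ T*`) ⟹ `GM3Fibre L Δ`. [folklore] -/
theorem certLogic_holds (hL : 4 ≤ L) {Δ : ℝ} (hΔ : Δ ≠ 0) : CertLogic L Δ :=
  certLogic_of_kreinForward L (kreinForward_holds L hL hΔ)

end Summit.HubbardSuperconductivity.HubbardSuperconductivity.Theorems.AnisotropyChord.Transfer.Fibre3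

end
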